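import Mathlib
import Summits.KontsevichZagierPeriods.Zeta5Search.Certificates.RecordRayPhatData
import HarnessLib

/-! # Record ray, (N) for every `n ≥ 1` — identification points 02/12: `j = 60 … 89` (S4-R1 item #10, step N-2c)

30 of the 356 kernel point identities `identAt k` (`RecordRayPhatData`), `k = j − 177`, one theorem per point, each
`decide +kernel` (≈ 3 s; fam-tele's computable mirror `PgenM` of the integer period matrix against `(c0 · Ĝ(k)) • P̂(k)`),
and their assembly `chunk_2` on the index interval `[60, 90)`.  The twelve chunks are concatenated in `RecordRayIdentWindow`.

Provenance: gen-2 g32's kernel-checked scratch `AllN_G15.lean` (2026-08-22, rc 0 / 0 sorry, axioms propext ·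
Classical.choice · Quot.sound), built on fam-tele g15's generic record-ray interface (`RecordRayGenericForms/Steps`,
`RecordRayMirror`, `RecordRayRaySteps`, `RecordRayChain`, all in the tree); data from gen-2 g31 (`P̂`, align) and fam-tele
g14 (`conn/PATH.md`).  Staged for the tree by gen-2 g33 (S4-R1 item #10).

HONEST FRAMING: systematic search; no irrationality claim unless certified; this is clause (N) of Brown–Zudilin's Theorem 1
(arXiv:2210.03391) for THEIR OWN record cell — the non-vanishing of their linear forms — and nothing about ζ(5) beyond that;
records UNMOVED. -/

namespace Summit.KontsevichZagierPeriods.Zeta5Search.RecordRay.Generic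

section Window

/- The point evaluations are memory-hungry kernel reductions (≈ 3 s each); elaborating them in PARALLEL killed a farm
   node twice (gen-2 g32).  Serialize them. -/
set_option Elab.async false

/-- Point identity `PgenM k = (c0 · Ĝ(k)) • P̂(k)` at `k = 60 − 177 = -117` (kernel `decide`). -/
theorem ip_60 : IdP 60 = true := by decide +kernel
/-- Point identity `PgenM k = (c0 · Ĝ(k)) • P̂(k)` at `k = 61 − 177 = -116` (kernel `decide`). -/
theorem ip_61 : IdP 61 = true := by decide +kernel
/-- Point identity `PgenM k = (c0 · Ĝ(k)) • P̂(k)` at `k = 62 − 177 = -115` (kernel `decide`). -/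
theorem ip_62 : IdP 62 = true := by decide +kernel
/-- Point identity `PgenM k = (c0 · Ĝ(k)) • P̂(k)` at `k = 63 − 177 = -114` (kernel `decide`). -/
theorem ip_63 : IdP 63 = true := by decide +kernel
/-- Point identity `PgenM k = (c0 · Ĝ(k)) • P̂(k)` at `k = 64 − 177 = -113` (kernel `decide`). -/
theorem ip_64 : IdP 64 = true := by decide +kernel
/-- Point identity `PgenM k = (c0 · Ĝ(k)) • P̂(k)` at `k = 65 − 177 = -112` (kernel `decide`). -/
theorem ip_65 : IdP 65 = true := by decide +kernel
/-- Point identity `PgenM k = (c0 · Ĝ(k)) • P̂(k)` at `k = 66 − 177 = -111` (kernel `decide`). -/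
theorem ip_66 : IdP 66 = true := by decide +kernel
/-- Point identity `PgenM k = (c0 · Ĝ(k)) • P̂(k)` at `k = 67 − 177 = -110` (kernel `decide`). -/
theorem ip_67 : IdP 67 = true := by decide +kernel
/-- Point identity `PgenM k = (c0 · Ĝ(k)) • P̂(k)` at `k = 68 − 177 = -109` (kernel `decide`). -/
theorem ip_68 : IdP 68 = true := by decide +kernel
/-- Point identity `PgenM k = (c0 · Ĝ(k)) • P̂(k)` at `k = 69 − 177 = -108` (kernel `decide`). -/
theorem ip_69 : IdP 69 = true := by decide +kernel
/-- Point identity `PgenM k = (c0 · Ĝ(k)) • P̂(k)` at `k = 70 − 177 = -107` (kernel `decide`). -/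
theorem ip_70 : IdP 70 = true := by decide +kernel
/-- Point identity `PgenM k = (c0 · Ĝ(k)) • P̂(k)` at `k = 71 − 177 = -106` (kernel `decide`). -/
theorem ip_71 : IdP 71 = true := by decide +kernel
/-- Point identity `PgenM k = (c0 · Ĝ(k)) • P̂(k)` at `k = 72 − 177 = -105` (kernel `decide`). -/
theorem ip_72 : IdP 72 = true := by decide +kernel
/-- Point identity `PgenM k = (c0 · Ĝ(k)) • P̂(k)` at `k = 73 − 177 = -104` (kernel `decide`). -/
theorem ip_73 : IdP 73 = true := by decide +kernel
/-- Point identity `PgenM k = (c0 · Ĝ(k)) • P̂(k)` at `k = 74 − 177 = -103` (kernel `decide`). -/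
theorem ip_74 : IdP 74 = true := by decide +kernel
/-- Point identity `PgenM k = (c0 · Ĝ(k)) • P̂(k)` at `k = 75 − 177 = -102` (kernel `decide`). -/
theorem ip_75 : IdP 75 = true := by decide +kernel
/-- Point identity `PgenM k = (c0 · Ĝ(k)) • P̂(k)` at `k = 76 − 177 = -101` (kernel `decide`). -/
theorem ip_76 : IdP 76 = true := by decide +kernel
/-- Point identity `PgenM k = (c0 · Ĝ(k)) • P̂(k)` at `k = 77 − 177 = -100` (kernel `decide`). -/
theorem ip_77 : IdP 77 = true := by decide +kernel
/-- Point identity `PgenM k = (c0 · Ĝ(k)) • P̂(k)` at `k = 78 − 177 = -99` (kernel `decide`). -/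
theorem ip_78 : IdP 78 = true := by decide +kernel
/-- Point identity `PgenM k = (c0 · Ĝ(k)) • P̂(k)` at `k = 79 − 177 = -98` (kernel `decide`). -/
theorem ip_79 : IdP 79 = true := by decide +kernel
/-- Point identity `PgenM k = (c0 · Ĝ(k)) • P̂(k)` at `k = 80 − 177 = -97` (kernel `decide`). -/
theorem ip_80 : IdP 80 = true := by decide +kernel
/-- Point identity `PgenM k = (c0 · Ĝ(k)) • P̂(k)` at `k = 81 − 177 = -96` (kernel `decide`). -/
theorem ip_81 : IdP 81 = true := by decide +kernel
/-- Point identity `PgenM k = (c0 · Ĝ(k)) • P̂(k)` at `k = 82 − 177 = -95` (kernel `decide`). -/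
theorem ip_82 : IdP 82 = true := by decide +kernel
/-- Point identity `PgenM k = (c0 · Ĝ(k)) • P̂(k)` at `k = 83 − 177 = -94` (kernel `decide`). -/
theorem ip_83 : IdP 83 = true := by decide +kernel
/-- Point identity `PgenM k = (c0 · Ĝ(k)) • P̂(k)` at `k = 84 − 177 = -93` (kernel `decide`). -/
theorem ip_84 : IdP 84 = true := by decide +kernel
/-- Point identity `PgenM k = (c0 · Ĝ(k)) • P̂(k)` at `k = 85 − 177 = -92` (kernel `decide`). -/
theorem ip_85 : IdP 85 = true := by decide +kernel
/-- Point identity `PgenM k = (c0 · Ĝ(k)) • P̂(k)` at `k = 86 − 177 = -91` (kernel `decide`). -/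
theorem ip_86 : IdP 86 = true := by decide +kernel
/-- Point identity `PgenM k = (c0 · Ĝ(k)) • P̂(k)` at `k = 87 − 177 = -90` (kernel `decide`). -/
theorem ip_87 : IdP 87 = true := by decide +kernel
/-- Point identity `PgenM k = (c0 · Ĝ(k)) • P̂(k)` at `k = 88 − 177 = -89` (kernel `decide`). -/
theorem ip_88 : IdP 88 = true := by decide +kernel
/-- Point identity `PgenM k = (c0 · Ĝ(k)) • P̂(k)` at `k = 89 − 177 = -88` (kernel `decide`). -/
theorem ip_89 : IdP 89 = true := by decide +kernel

/-- The point identities for `60 ≤ j < 90` (`k = -117 … -88`), assembled. -/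
theorem chunk_2 : ∀ j : ℕ, 60 ≤ j → j < 90 → IdP j = true :=
  chunk_step ip_60 <| chunk_step ip_61 <| chunk_step ip_62 <| chunk_step ip_63 <| chunk_step ip_64 <|
  chunk_step ip_65 <| chunk_step ip_66 <| chunk_step ip_67 <| chunk_step ip_68 <| chunk_step ip_69 <|
  chunk_step ip_70 <| chunk_step ip_71 <| chunk_step ip_72 <| chunk_step ip_73 <| chunk_step ip_74 <|
  chunk_step ip_75 <| chunk_step ip_76 <| chunk_step ip_77 <| chunk_step ip_78 <| chunk_step ip_79 <|
  chunk_step ip_80 <| chunk_step ip_81 <| chunk_step ip_82 <| chunk_step ip_83 <| chunk_step ip_84 <|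
  chunk_step ip_85 <| chunk_step ip_86 <| chunk_step ip_87 <| chunk_step ip_88 <| chunk_step ip_89 <| chunk_base

end Window

end Summit.KontsevichZagierPeriods.Zeta5Search.RecordRay.Generic
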